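import Summits.Parity.GeneralizedHardyLittlewood.Theorems.GreenTaoLevelTwoGITwoCyclicInverseCauchySchwarz
import Summits.Parity.GeneralizedHardyLittlewood.Theorems.GreenTaoLevelTwoGITwoCyclicInversePopular
import Mathlib.Analysis.SpecialFunctions.Complex.Circle

/-!
# Route `GreenTaoLevelTwo`, crux `GITwo` (stmt-Parity-21275), line `birth`, stub `stub_cyclicInverse`:
# the symmetry argument, middle step: a popular difference (GT08a arXiv Lemma 46, (eq9.75') ⇒ `y', A`)

Forty-third helper file toward the XL stub `stub_cyclicInverse` (B. Green, T. Tao, *An inverse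
theorem for the Gowers `U³(G)` norm*, arXiv:math/0503014, Thm. 68 = PEMS 51 (2008) Thm. 12.8).
Block C12: the step of the proof of arXiv Lemma 46 between display (eq9.75')
(`|Σ_{x,y∈B₂} b(x) b'(y) e({x,y})| ≥ c₃ #B₂²`) and the input of `symmetry_endgame`
(`…SymmetryEndgame`): Cauchy–Schwarz in `x` (arXiv Lemma 22, `norm_sum_mul_sum_sq_le`), the
local bilinearity `{x,y'} − {x,y} = {x, y'−y}`, pigeonhole in `y'` and the popularity step
(`card_filter_ge_of_sum_ge`) produce `y' ∈ B₂` and many `y ∈ B₂` with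
`|Σ_{x∈B₂} e({x, y'−y})| ≥ (c₃²/2) #B₂`.  Here `{x,y} = toAddCircle(μ(x)y) − toAddCircle(μ(y)x)` and
`e = AddCircle.toCircle`.

* `conj_coe_toCircle` — `conj e(θ) = e(−θ)`;
* `exists_popular_difference` — the statement above.

References: [GreenTao2008U3Inverse] arXiv:math/0503014, Lemma 46 (middle of the proof).
-/

noncomputable section

namespace Summit.Parity.GeneralizedHardyLittlewood.GreenTaoLevelTwoGITwoCyclicInverse

open Finset
open scoped ComplexConjugate

variable {N : ℕ} [NeZero N]

omit [NeZero N] in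
/-- `conj e(θ) = e(−θ)` for `e = AddCircle.toCircle` on `ℝ/ℤ`. [folklore] -/
theorem conj_coe_toCircle (θ : UnitAddCircle) :
    conj ((AddCircle.toCircle θ : Circle) : ℂ) = ((AddCircle.toCircle (-θ) : Circle) : ℂ) := by
  rw [AddCircle.toCircle_neg, Circle.coe_inv_eq_conj]

/-- **Middle step of the symmetry argument (GT08a arXiv Lemma 46).**  Let `B₂ ⊆ ℤ/Nℤ` be a nonempty
finset, `μ : ℤ/Nℤ → ℤ/Nℤ` with `μ(y' − y) + μ y = μ y'` for `y, y' ∈ B₂`, and `b, b'` weights bounded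
by `1` on `B₂`.  If `|Σ_{x∈B₂} Σ_{y∈B₂} b(x) b'(y) e({x,y})| ≥ c₃ #B₂²` (`c₃ > 0`), then some `y' ∈ B₂`
has at least `(c₃²/2) #B₂` elements `y ∈ B₂` with `|Σ_{x∈B₂} e({x, y'−y})| ≥ (c₃²/2) #B₂`.
[cite: GreenTao2008U3Inverse, Lemma 46] -/
theorem exists_popular_difference (B₂ : Finset (ZMod N)) (hB₂ : B₂.Nonempty) (μ : ZMod N → ZMod N)
    (hadd : ∀ y ∈ B₂, ∀ y' ∈ B₂, μ (y' - y) + μ y = μ y') (b b' : ZMod N → ℂ)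
    (hb : ∀ x ∈ B₂, ‖b x‖ ≤ 1) (hb' : ∀ y ∈ B₂, ‖b' y‖ ≤ 1) {c₃ : ℝ} (hc₃ : 0 < c₃)
    (hbig : c₃ * (#B₂ : ℝ) ^ 2 ≤ ‖∑ x ∈ B₂, ∑ y ∈ B₂, b x * b' y *
      ((AddCircle.toCircle (ZMod.toAddCircle (μ x * y) - ZMod.toAddCircle (μ y * x)) : Circle) : ℂ)‖) :
    ∃ y' ∈ B₂, c₃ ^ 2 / 2 * #B₂ ≤ #(B₂.filter fun y => c₃ ^ 2 / 2 * #B₂ ≤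
      ‖∑ x ∈ B₂, ((AddCircle.toCircle
        (ZMod.toAddCircle (μ x * (y' - y)) - ZMod.toAddCircle (μ (y' - y) * x)) : Circle) : ℂ)‖) := by
  classical
  have hc0 : (0 : ℝ) < #B₂ := by exact_mod_cast hB₂.card_pos
  -- notation for the form and the character
  set e : ZMod N → ZMod N → ℂ := fun x y =>
    ((AddCircle.toCircle (ZMod.toAddCircle (μ x * y) - ZMod.toAddCircle (μ y * x)) : Circle) : ℂ)
    with he
  have he1 : ∀ x y, ‖e x y‖ = 1 := fun x y => by rw [he]; exact Circle.norm_coe _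
  -- Cauchy–Schwarz in `x`
  have hT : ∑ x ∈ B₂, ∑ y ∈ B₂, b x * b' y * e x y = ∑ x ∈ B₂, b x * ∑ y ∈ B₂, b' y * e x y := by
    refine sum_congr rfl fun x _ => ?_
    rw [mul_sum]
    exact sum_congr rfl fun y _ => by ring
  have hCS := norm_sum_mul_sum_sq_le B₂ B₂ (fun x y => b' y * e x y) b hb
  rw [← hT] at hCS
  -- the expansion of `Σ_x ‖Σ_y b'(y) e(x,y)‖²`
  have hexp := ofReal_sum_norm_sum_sq B₂ B₂ (fun x y => b' y * e x y)
  -- the difference identity `e(x,y') conj e(x,y) = e({x, y'−y})`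
  have hdiff : ∀ x : ZMod N, ∀ y ∈ B₂, ∀ y' ∈ B₂,
      e x y' * conj (e x y) = ((AddCircle.toCircle
        (ZMod.toAddCircle (μ x * (y' - y)) - ZMod.toAddCircle (μ (y' - y) * x)) : Circle) : ℂ) := by
    intro x y hy y' hy'
    rw [he]
    simp only
    rw [conj_coe_toCircle, ← Circle.coe_mul, ← AddCircle.toCircle_add]
    congr 2
    have hμ : μ y' = μ (y' - y) + μ y := (hadd y hy y' hy').symm
    rw [hμ, mul_sub, add_mul, map_sub, map_add]
    abel
  -- `Σ_x ‖Σ_y …‖² ≤ Σ_{y'} Σ_y ‖Σ_x e({x, y'−y})‖`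
  have hbound : ∑ x ∈ B₂, ‖∑ y ∈ B₂, b' y * e x y‖ ^ 2 ≤
      ∑ y' ∈ B₂, ∑ y ∈ B₂, ‖∑ x ∈ B₂, ((AddCircle.toCircle
        (ZMod.toAddCircle (μ x * (y' - y)) - ZMod.toAddCircle (μ (y' - y) * x)) : Circle) : ℂ)‖ := by
    have h1 : (∑ x ∈ B₂, ‖∑ y ∈ B₂, b' y * e x y‖ ^ 2 : ℝ) =
        ‖((∑ x ∈ B₂, ‖∑ y ∈ B₂, b' y * e x y‖ ^ 2 : ℝ) : ℂ)‖ := by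
      rw [Complex.norm_real, Real.norm_eq_abs, abs_of_nonneg (by positivity)]
    rw [h1, hexp]
    -- regroup: `Σ_x Σ_{y'} Σ_y F = Σ_{y'} Σ_y (b' y' conj b' y) Σ_x e({x,y'−y})`
    have h2 : ∑ x ∈ B₂, ∑ y' ∈ B₂, ∑ y ∈ B₂, (b' y' * e x y') * conj (b' y * e x y) =
        ∑ y' ∈ B₂, ∑ y ∈ B₂, (b' y' * conj (b' y)) * ∑ x ∈ B₂, ((AddCircle.toCircle
          (ZMod.toAddCircle (μ x * (y' - y)) - ZMod.toAddCircle (μ (y' - y) * x)) : Circle) : ℂ) := by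
      rw [Finset.sum_comm]
      refine sum_congr rfl fun y' hy' => ?_
      rw [Finset.sum_comm]
      refine sum_congr rfl fun y hy => ?_
      rw [mul_sum]
      refine sum_congr rfl fun x _ => ?_
      rw [map_mul, ← hdiff x y hy y' hy']
      ring
    rw [h2]
    refine (norm_sum_le _ _).trans (sum_le_sum fun y' hy' => ?_)
    refine (norm_sum_le _ _).trans (sum_le_sum fun y hy => ?_)
    rw [norm_mul, norm_mul, Complex.norm_conj]
    calc ‖b' y'‖ * ‖b' y‖ * _ ≤ 1 * 1 * _ :=
          mul_le_mul_of_nonneg_right (mul_le_mul (hb' y' hy') (hb' y hy) (norm_nonneg _) zero_le_one)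
            (norm_nonneg _)
      _ = _ := by ring
  -- combine: `c₃² #B₂⁴ ≤ #B₂ · Σ_{y'} Σ_y ‖…‖`
  have hchain : c₃ ^ 2 * (#B₂ : ℝ) ^ 4 ≤ #B₂ * ∑ y' ∈ B₂, ∑ y ∈ B₂, ‖∑ x ∈ B₂, ((AddCircle.toCircle
        (ZMod.toAddCircle (μ x * (y' - y)) - ZMod.toAddCircle (μ (y' - y) * x)) : Circle) : ℂ)‖ := by
    have h1 : c₃ ^ 2 * (#B₂ : ℝ) ^ 4 ≤ ‖∑ x ∈ B₂, ∑ y ∈ B₂, b x * b' y * e x y‖ ^ 2 := by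
      have := pow_le_pow_left₀ (by positivity) hbig 2
      calc c₃ ^ 2 * (#B₂ : ℝ) ^ 4 = (c₃ * (#B₂ : ℝ) ^ 2) ^ 2 := by ring
        _ ≤ _ := this
    exact h1.trans (hCS.trans (mul_le_mul_of_nonneg_left hbound (Nat.cast_nonneg _)))
  -- pigeonhole in `y'`
  have havg : ∑ y' ∈ B₂, c₃ ^ 2 * (#B₂ : ℝ) ^ 2 ≤ ∑ y' ∈ B₂, ∑ y ∈ B₂, ‖∑ x ∈ B₂, ((AddCircle.toCircle
        (ZMod.toAddCircle (μ x * (y' - y)) - ZMod.toAddCircle (μ (y' - y) * x)) : Circle) : ℂ)‖ := by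
    rw [sum_const, nsmul_eq_mul]
    have := hchain
    refine le_of_mul_le_mul_left ?_ hc0
    calc (#B₂ : ℝ) * (#B₂ * (c₃ ^ 2 * (#B₂ : ℝ) ^ 2)) = c₃ ^ 2 * (#B₂ : ℝ) ^ 4 := by ring
      _ ≤ _ := hchain
  obtain ⟨y', hy', hy'sum⟩ := exists_le_of_sum_le hB₂ havg
  refine ⟨y', hy', ?_⟩
  -- popularity in `y` with `g(y) = ‖Σ_x e({x,y'−y})‖ / #B₂`
  have hpop := card_filter_ge_of_sum_ge B₂ (fun y => ‖∑ x ∈ B₂, ((AddCircle.toCircle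
      (ZMod.toAddCircle (μ x * (y' - y)) - ZMod.toAddCircle (μ (y' - y) * x)) : Circle) : ℂ)‖ / #B₂)
    (c := c₃ ^ 2) (by positivity) (fun y _ => by
      rw [div_le_one hc0]
      refine (norm_sum_le _ _).trans (le_of_eq ?_)
      rw [sum_congr rfl fun x _ => Circle.norm_coe _]
      simp) (by
      rw [← sum_div, le_div_iff₀ hc0]
      calc c₃ ^ 2 * (#B₂ : ℝ) * #B₂ = c₃ ^ 2 * (#B₂ : ℝ) ^ 2 := by ring
        _ ≤ _ := hy'sum)
  have hfilt : (B₂.filter fun y => c₃ ^ 2 / 2 ≤ ‖∑ x ∈ B₂, ((AddCircle.toCircle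
      (ZMod.toAddCircle (μ x * (y' - y)) - ZMod.toAddCircle (μ (y' - y) * x)) : Circle) : ℂ)‖ / #B₂) =
      (B₂.filter fun y => c₃ ^ 2 / 2 * #B₂ ≤ ‖∑ x ∈ B₂, ((AddCircle.toCircle
        (ZMod.toAddCircle (μ x * (y' - y)) - ZMod.toAddCircle (μ (y' - y) * x)) : Circle) : ℂ)‖) :=
    Finset.filter_congr fun y _ => by rw [le_div_iff₀ hc0]
  rw [hfilt] at hpop
  exact hpop

end Summit.Parity.GeneralizedHardyLittlewood.GreenTaoLevelTwoGITwoCyclicInverse
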